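import Summits.Langlands.Langlands.Theorems.PicardMuOrdinaryMuOrdinaryFamilyRTMod3nDefs

/-!
# Crux `MuOrdinaryFamilyRT` (stmt-Langlands-13757), line `mod3n-successive-approximation`:
# stub K2 `stub_levelLowering` — its kernel-checkable part: precision monotonicity of `AutomorphicMod`

The registered stub `S.stub_levelLowering` (K2, Mazur's principle modulo `3^N` on the definite `U(3)_{K/ℚ}`:
`AutomorphicMod hcpt ι (N + c) S₀ Y ρ_C → AutomorphicMod hcpt ι N S₀ ∅ ρ_C` for a set `Y` of Lie-killing places,
vocabulary of the landed `Theorems/PicardMuOrdinaryMuOrdinaryFamilyRTMod3nDefs.lean`, p117850) has two parts: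

* `Y = ∅`.  Then the level does not change and K2 is **precision monotonicity**: a witness of automorphy modulo
  `3^{N+c}` is a witness modulo `3^N`.  This is TRUE and is proved here, sorry-free, for every level `(S₀; Y)` and
  every `M ≤ N` (`AutomorphicMod.of_le`, `automorphicMod_mono_precision`, `levelLowering_of_empty`): in
  `AutomorphicMod hcpt ι N S₀ Y ρ_C` the frame clause `IsBorelFrameAt`, the witness clauses `IsAutomorphicOfLevel`,
  `IsPolarized`, `IsBorelFrameAt`, `InertiallyBoundedBy`, `IsUnipotentOnInertiaAt` and the residual clause (`< 1`) do
  not mention `N`; the weight clause, the two "through `ρ_C`" clauses and `IsApproxPoint ((3⁻¹)^N) …` are of the form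
  `‖…‖ ≤ (3⁻¹)^N` (resp. `≤ r` with `r = (3⁻¹)^N`, `IsApproxPoint.mono`), and `(3⁻¹)^N ≤ (3⁻¹)^M` for `M ≤ N`.
* `Y ≠ ∅`.  The SAME witnesses `ρs i` cannot serve at level `S₀`: they are only `IsAutomorphicOfLevel hcpt ι (S₀ ∪ Y)`,
  i.e. their cuspidal `P` is asked to be unramified with integral Satake trace and `IsGaloisCompatibleAt P.1 ι (ρs i) 𝔭`
  only at `𝔭 ∉ S₀ ∪ Y`, and at `𝔭 ∈ Y` nothing is known (`IsGaloisCompatibleAt` quantifies over Satake parameters of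
  `P` at `𝔭`, whose existence at `𝔭 ∈ Y` is exactly what level `S₀` demands and level `S₀ ∪ Y` does not give).  New
  witnesses unramified at `Y` congruent modulo `3^N` to the old ones are the content of level lowering modulo `p^N`
  (Thorne 2016 Thm 4.14 / Prop 4.16, Khare–Thorne 2016 Thm 5.4 — quaternionic `GL₂` only; for the definite `U(3)`:
  Ihara's lemma in the unipotent case at split `w`, an unwritten tree argument at inert `w`).  No named fact of the
  tree states any form of it (searched: `levelLowering`, `MazurPrinciple`, `Ihara`, `levelRaising`, Ribet); the stub is
  reported blocked on that unsourced statement, and nothing about the case `Y ≠ ∅` is asserted in this file.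
-/

-- `Summit.Langlands.Langlands.…` (summit = sub-problem name, D-0017 layout) trips `dupNamespace` on every decl.
set_option linter.dupNamespace false

namespace Summit.Langlands.Langlands.Cruxes.MuOrdinaryFamilyRT.Mod3nSuccessiveApproximation

open scoped NumberField Polynomial Matrix Classical
open Field IsDedekindDomain Polynomial
open Literature.NumberTheory.GaloisRepresentations Literature.NumberTheory.Automorphic
open Summit.Langlands.Langlands.Cruxes.MuOrdinaryFamilyRT.CharZeroDominance
  (K Generic PicardInput instIsGaloisK)

noncomputable section

/-- The precision `3^{-N}` is antitone in `N`. -/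
theorem inv_three_pow_le_of_le {M N : ℕ} (hMN : M ≤ N) : ((3 : ℝ)⁻¹) ^ N ≤ ((3 : ℝ)⁻¹) ^ M :=
  pow_le_pow_of_le_one (by positivity) (by norm_num) hMN

/-- An approximate `𝒪`-algebra point of precision `r` is one of every coarser precision `r' ≥ r`. -/
theorem IsApproxPoint.mono {m : ℕ} {r r' : ℝ} {G : Set (Fin m → PadicAlgCl 3)}
    {θ : (Fin m → PadicAlgCl 3) → PadicAlgCl 3} (hr : r ≤ r') (h : IsApproxPoint r G θ) :
    IsApproxPoint r' G θ := by
  obtain ⟨h₁, h₂, h₃, h₄⟩ := h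
  exact ⟨h₁, h₂.trans hr, fun a ha b hb => ⟨(h₃ a ha b hb).1.trans hr, (h₃ a ha b hb).2.trans hr⟩,
    fun c a ha => (h₄ c a ha).trans hr⟩

/-- **Precision monotonicity of automorphy modulo `3^N`.**  At a fixed level `(S₀; Y)`, automorphy of `ρ_C` modulo
`3^N` implies automorphy modulo `3^M` for every `M ≤ N`, with the same frame, witnesses and approximate point. -/
theorem AutomorphicMod.of_le {hcpt : isCompact_glFiniteIntegralLevel 3 (CyclotomicField 3 ℚ)}
    {ι : PadicAlgCl 3 ≃+* ℂ} {M N : ℕ} {S₀ Y : Finset (HeightOneSpectrum (𝓞 K))}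
    {ρC : FramedGaloisRep K (PadicAlgCl 3) 3} (hMN : M ≤ N) (h : AutomorphicMod hcpt ι N S₀ Y ρC) :
    AutomorphicMod hcpt ι M S₀ Y ρC := by
  intro v hv
  obtain ⟨g, m, ρs, gs, θ, hg, hρs, hθ, hθ₁, hθ₂⟩ := h v hv
  have hle := inv_three_pow_le_of_le hMN
  refine ⟨g, m, ρs, gs, θ, hg, fun i => ?_, hθ.mono hle, fun σ k => (hθ₁ σ k).trans hle,
    fun τ j => (hθ₂ τ j).trans hle⟩
  obtain ⟨h₁, h₂, h₃, h₄, h₅, h₆, h₇⟩ := hρs i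
  exact ⟨h₁, h₂, h₃, h₄, h₅, h₆, fun τ hτ j => (h₇ τ hτ j).trans hle⟩

/-- **Precision monotonicity, in the shape of K2** (registered sub-goal `automorphicMod_mono_precision`): for every
precision loss `c`, automorphy modulo `3^{N+c}` at level `(S₀; Y)` implies automorphy modulo `3^N` at the SAME level. -/
theorem automorphicMod_mono_precision :
    ∀ (hcpt : isCompact_glFiniteIntegralLevel 3 (CyclotomicField 3 ℚ)) (ι : PadicAlgCl 3 ≃+* ℂ) (N c : ℕ)
      (S₀ Y : Finset (HeightOneSpectrum (𝓞 K))) (ρC : FramedGaloisRep K (PadicAlgCl 3) 3),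
      AutomorphicMod hcpt ι (N + c) S₀ Y ρC → AutomorphicMod hcpt ι N S₀ Y ρC :=
  fun _ _ N c _ _ _ h => h.of_le (Nat.le_add_right N c)

/-- **The case `Y = ∅` of K2 is precision monotonicity**: `S.stub_levelLowering` with its auxiliary level `Y`
specialised to `∅` holds for EVERY `c`, unconditionally in `(f, ρ_C)` — so the whole content of K2 is the removal of a
non-empty auxiliary level `Y` (level lowering proper). -/
theorem levelLowering_of_empty (hcpt : isCompact_glFiniteIntegralLevel 3 (CyclotomicField 3 ℚ))
    (ι : PadicAlgCl 3 ≃+* ℂ) (S₀ : Finset (HeightOneSpectrum (𝓞 K))) (ρC : FramedGaloisRep K (PadicAlgCl 3) 3)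
    (c N : ℕ) : AutomorphicMod hcpt ι (N + c) S₀ ∅ ρC → AutomorphicMod hcpt ι N S₀ ∅ ρC :=
  automorphicMod_mono_precision hcpt ι N c S₀ ∅ ρC

end

end Summit.Langlands.Langlands.Cruxes.MuOrdinaryFamilyRT.Mod3nSuccessiveApproximation
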